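import Summits.ResolutionOfSingularities.ResolutionOfSingularities.Theorems.PinchTowerCone

/-!
# PinchTower (P4/8) — the PINCH SHAPE at a point of the tower (bundled data) and the three EXITS

Node «PinchTower» of `decomp-res-lens-2` (g31), see `Theorems/MaxContactCutPinchTower.lean`.

* §S `PinchShape J E n a`: regular parameters `(z, u)` with `(u)` the exceptional stalk, `zⁿ + uᵃ·(λ vᵏ) + g ∈ J` with
  `λ` a unit, `k = 0` or `(z, u, v)` regular parameters, `g ∈ Q(na + 1)`, `J ⊆ Q(na)` and the PINCH EXIT CONDITION
  `PinchExitCond κ n k a λ̄` of the landed `PinchCut.IsPinchAt` (with `a` in place of `m`; `a ≡ m (mod n)` down the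
  tower).  Basic consequences (the Σ-stalk `√(J + (u)) = (z, u)`, `J ⊆ 𝔪ⁿ` for `n ≤ a`, regular quotient) —
  re-runs of `TowerCut.ShapeData`.
* §E the EXIT at the last stage `a < n`, `J ⊆ 𝔪ⁿ` ⇒ `τ(J, n) ≥ 2` in some regular system of parameters:
  `k + a < n` (and `a = k = 0`) is impossible (`pinch_not_mem_pow`), `k + a = n` with `a, k ≥ 1` is the mixed exit
  `pinch_two_le_tau` (E12), and `a = 0`, `k = n`, `λ̄` not a cone power is the non-power exit (E34):
  `two_le_hironakaTau_pinchForm` (the form `X₀ⁿ + λ̄ X₂ⁿ + X₁·H` has `τ ≥ 2` — `τ = 1` would give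
  `1 + λ̄ Tⁿ = c (α + β T)ⁿ` in `κ[T]`, `isConePower_of_one_add_eq`).
-/

open IsLocalRing MvPolynomial
open Literature.AlgebraicGeometry.Resolution
open Summit.ResolutionOfSingularities.ResolutionOfSingularities.Theorems.DeltaFaceCutClasses (qWeighted)
open Summit.ResolutionOfSingularities.ResolutionOfSingularities.Theorems.TowerCut
open Summit.ResolutionOfSingularities.ResolutionOfSingularities.Theorems.PinchCut (IsConePower PinchExitCond)

namespace Summit.ResolutionOfSingularities.ResolutionOfSingularities.Theorems.PinchTower

/-! ## §S  THE PINCH SHAPE at a point of the tower (bundled data, `Type`-valued) -/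

section Shape

/-- **PINCH SHAPE DATA** at a point (ring level, over the stalk `A`): see the file docstring.  DATA (a `structure` in
`Type`, not a proposition / cell). [folklore] -/
structure PinchShape {A : Type} [CommRing A] [IsLocalRing A] (J E : Ideal A) (n a : ℕ) where
  /-- the corner parameter `z` -/
  z : A
  /-- the exceptional parameter `u` -/
  u : A
  /-- the transversal parameter `v` (irrelevant when `k = 0`) -/
  v : A
  /-- the unit `λ` -/
  lam : A
  /-- the tail `g` -/
  g : A
  /-- the exponent `k` of `v` -/
  k : ℕ
  rsop : IsRsopPart ![z, u]
  vk : k = 0 ∨ IsRsopPart ![z, u, v]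
  unit : IsUnit lam
  exc : E = Ideal.span {u}
  mem : z ^ n + u ^ a * (lam * v ^ k) + g ∈ J
  tail : g ∈ qWeighted ![z, u] a n (n * a + 1)
  deep : J ≤ qWeighted ![z, u] a n (n * a)
  cond : PinchExitCond (ResidueField A) n k a (residue A lam)

variable {A : Type} [CommRing A] [IsLocalRing A] {J E : Ideal A} {n a : ℕ}

namespace PinchShape

/-- The frame ideal contains `u`. [folklore] -/
theorem u_mem_span (D : PinchShape J E n a) : D.u ∈ Ideal.span (Set.range ![D.z, D.u]) :=
  Ideal.subset_span ⟨1, rfl⟩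

/-- `z ∈ 𝔪`. [folklore] -/
theorem z_mem (D : PinchShape J E n a) : D.z ∈ maximalIdeal A := D.rsop.mem_maximalIdeal 0

/-- `u ∈ 𝔪`. [folklore] -/
theorem u_mem (D : PinchShape J E n a) : D.u ∈ maximalIdeal A := D.rsop.mem_maximalIdeal 1

/-- `v ∈ 𝔪` unless `k = 0`. [folklore] -/
theorem v_mem (D : PinchShape J E n a) (hk : D.k ≠ 0) : D.v ∈ maximalIdeal A := by
  rcases D.vk with h | h
  · exact absurd h hk
  · exact h.mem_maximalIdeal 2

/-- `λ vᵏ ∈ 𝔪` unless `k = 0`. [folklore] -/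
theorem lam_mul_v_pow_mem (D : PinchShape J E n a) (hk : D.k ≠ 0) : D.lam * D.v ^ D.k ∈ maximalIdeal A := by
  obtain ⟨k', hk'⟩ : ∃ k', D.k = k' + 1 := ⟨D.k - 1, by omega⟩
  rw [hk', pow_succ, ← mul_assoc]
  exact Ideal.mul_mem_left _ _ (D.v_mem hk)

/-- `λ̄ ≠ 0`. [folklore] -/
theorem residue_lam_ne_zero (D : PinchShape J E n a) : residue A D.lam ≠ 0 := fun h =>
  (IsLocalRing.notMem_maximalIdeal.mpr D.unit) ((IsLocalRing.residue_eq_zero_iff _).mp h)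

/-- The frame ideal `(z, u)` is prime. [folklore] -/
theorem isPrime_span (D : PinchShape J E n a) : (Ideal.span (Set.range ![D.z, D.u])).IsPrime :=
  D.rsop.isPrime_span_range

/-- `J ⊆ (z, u)` (`1 ≤ n a`). [folklore] -/
theorem le_span (D : PinchShape J E n a) (hna : 1 ≤ n * a) : J ≤ Ideal.span (Set.range ![D.z, D.u]) :=
  D.deep.trans (qWeighted_le_span _ hna)

/-- Membership in `E`. [folklore] -/
theorem mem_exc_iff (D : PinchShape J E n a) {x : A} : x ∈ E ↔ x ∈ Ideal.span {D.u} :=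
  SetLike.ext_iff.mp D.exc x

/-- `u ∈ E`. [folklore] -/
theorem u_mem_exc (D : PinchShape J E n a) : D.u ∈ E := D.mem_exc_iff.mpr (Ideal.mem_span_singleton_self _)

/-- `E ⊆ (z, u)`. [folklore] -/
theorem exc_le_span (D : PinchShape J E n a) : E ≤ Ideal.span (Set.range ![D.z, D.u]) := by
  intro x hx
  obtain ⟨r, rfl⟩ := Ideal.mem_span_singleton'.mp (D.mem_exc_iff.mp hx)
  exact Ideal.mul_mem_left _ _ D.u_mem_span

/-- **`zⁿ ∈ J + (u)`** (`1 ≤ a`): `zⁿ(1 + r z) = h − uᵃλvᵏ − u s`. [folklore] -/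
theorem z_pow_mem_sup (D : PinchShape J E n a) (ha : 1 ≤ a) : D.z ^ n ∈ J ⊔ Ideal.span {D.u} := by
  obtain ⟨g₁, hg₁, g₂, hg₂, hg⟩ := Submodule.mem_sup.mp (qWeighted_succ_le_sup D.z D.u a n D.tail)
  obtain ⟨r, hr⟩ := Ideal.mem_span_singleton'.mp hg₁
  have hunit : IsUnit (1 + r * D.z) := by
    rw [← IsLocalRing.notMem_maximalIdeal]
    intro h
    have h1 : (1 : A) ∈ maximalIdeal A := by
      have := Ideal.sub_mem _ h (Ideal.mul_mem_left _ r D.z_mem)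
      rwa [add_sub_cancel_right] at this
    exact (maximalIdeal.isMaximal A).ne_top ((Ideal.eq_top_iff_one _).mpr h1)
  have hkey : D.z ^ n * (1 + r * D.z) ∈ J ⊔ Ideal.span {D.u} := by
    have heq : D.z ^ n * (1 + r * D.z) =
        (D.z ^ n + D.u ^ a * (D.lam * D.v ^ D.k) + D.g) - D.u ^ a * (D.lam * D.v ^ D.k) - g₂ := by
      rw [← hg, ← hr]; ring
    rw [heq]
    refine Ideal.sub_mem _ (Ideal.sub_mem _ (Ideal.mem_sup_left D.mem) (Ideal.mem_sup_right ?_))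
      (Ideal.mem_sup_right hg₂)
    obtain ⟨a', rfl⟩ : ∃ a', a = a' + 1 := ⟨a - 1, by omega⟩
    rw [pow_succ, mul_assoc]
    exact Ideal.mul_mem_left _ _ (Ideal.mul_mem_right _ _ (Ideal.mem_span_singleton_self _))
  obtain ⟨w, hw⟩ := hunit
  have : D.z ^ n = D.z ^ n * (1 + r * D.z) * ↑w⁻¹ := by
    rw [← hw, mul_assoc, Units.mul_inv, mul_one]
  rw [this]
  exact Ideal.mul_mem_right _ _ hkey

/-- **The Σ-stalk**: `√(J + E) = (z, u)` (`1 ≤ a`, `1 ≤ n`). [folklore] -/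
theorem radical_sup_eq (D : PinchShape J E n a) (ha : 1 ≤ a) (hn : 1 ≤ n) :
    (J ⊔ E).radical = Ideal.span (Set.range ![D.z, D.u]) := by
  haveI := D.isPrime_span
  apply le_antisymm
  · rw [Ideal.IsPrime.radical_le_iff ‹_›]
    exact sup_le (D.le_span (Nat.one_le_iff_ne_zero.mpr (Nat.mul_ne_zero_iff.mpr ⟨by omega, by omega⟩)))
      D.exc_le_span
  · rw [Ideal.span_le]
    rintro _ ⟨j, rfl⟩
    have hE : Ideal.span {D.u} ≤ E := fun x hx => D.mem_exc_iff.mpr hx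
    fin_cases j
    · exact ⟨n, sup_le_sup_left hE J (D.z_pow_mem_sup ha)⟩
    · exact Ideal.le_radical (Ideal.mem_sup_right D.u_mem_exc)

/-- **`J ⊆ 𝔪ⁿ`** while `n ≤ a`: `Q(na) ⊆ (z,u)ⁿ ⊆ 𝔪ⁿ`. [folklore] -/
theorem le_maximalIdeal_pow (D : PinchShape J E n a) (hna : n ≤ a) (ha : 0 < a) :
    J ≤ maximalIdeal A ^ n :=
  (D.deep.trans (qWeighted_le_pow _ hna ha le_rfl)).trans
    (Ideal.pow_right_mono D.rsop.span_range_le_maximalIdeal _)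

/-- The quotient by the Σ-stalk is a regular local ring. [folklore] -/
theorem isRegularLocalRing_quotient (D : PinchShape J E n a) :
    IsRegularLocalRing (A ⧸ Ideal.span (Set.range ![D.z, D.u])) :=
  D.rsop.isRegularLocalRing_quotient

end PinchShape

omit [IsLocalRing A] in
/-- **Tail shapes**: `Q^{(a,n)}(na + 1) ⊆ (z) + (u^{a+1})`. [folklore] -/
theorem qWeighted_succ_le_sup' (z u : A) (a n : ℕ) :
    qWeighted ![z, u] a n (n * a + 1) ≤ Ideal.span {z} ⊔ Ideal.span {u ^ (a + 1)} := by
  refine qWeighted_two_le fun i j hij => ?_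
  rcases Nat.eq_zero_or_pos i with rfl | hi
  · have hj : a + 1 ≤ j := by
      by_contra h
      have : n * j ≤ n * a := Nat.mul_le_mul_left _ (by omega)
      omega
    rw [pow_zero, one_mul]
    exact Ideal.mem_sup_right (Ideal.mem_span_singleton.mpr (pow_dvd_pow u hj))
  · refine Ideal.mem_sup_left (Ideal.mem_span_singleton.mpr ?_)
    exact Dvd.dvd.mul_right (dvd_pow_self z hi.ne') _

end Shape

/-! ## §E  THE EXITS at the last stage (`a < n`, `J ⊆ 𝔪ⁿ`): Hironaka's `τ(J, n) ≥ 2` -/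

section Exit

/-- **The non-power form has `τ ≥ 2`**: over a field `k`, `G = X_{i₀}ⁿ + λ X_{i₂}ⁿ + X_{i₁}·H` (`λ ≠ 0` not a cone
`n`-th power, `n ≥ 1`, three distinct indices) is neither a constant nor `c·ℓⁿ` for a linear form `ℓ`: substitute
`X_{i₀} ↦ 1`, `X_{i₂} ↦ T`, the rest `↦ 0` to get `1 + λ Tⁿ = c·(α + β T)ⁿ` in `k[T]` (`isConePower_of_one_add_eq`).
[folklore] -/
theorem two_le_hironakaTau_pinchForm (k : Type) [Field k] {d : ℕ} (i₀ i₁ i₂ : Fin d) (h01 : i₀ ≠ i₁)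
    (h02 : i₀ ≠ i₂) (h12 : i₁ ≠ i₂) {n : ℕ} (hn : 1 ≤ n) (lam : k) (hlam : lam ≠ 0)
    (hcone : ¬ IsConePower k n lam) (H G : MvPolynomial (Fin d) k)
    (hG : G = X i₀ ^ n + MvPolynomial.C lam * X i₂ ^ n + X i₁ * H) (hGh : G.IsHomogeneous n) :
    2 ≤ hironakaTau k ({G} : Set (MvPolynomial (Fin d) k)) := by
  classical
  have hn0 : n ≠ 0 := by omega
  -- the substitution `ω : X_{i₀} ↦ 1, X_{i₂} ↦ T, others ↦ 0`
  set w : Fin d → Polynomial k := fun i => if i = i₀ then 1 else if i = i₂ then Polynomial.X else 0 with hw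
  have hw0 : w i₀ = 1 := by simp [hw]
  have hw2 : w i₂ = Polynomial.X := by simp [hw, Ne.symm h02]
  have hw1 : w i₁ = 0 := by simp [hw, Ne.symm h01, h12]
  have hwdeg : ∀ i, (w i).natDegree ≤ 1 := fun i => by
    simp only [hw]
    split_ifs
    · simp
    · exact Polynomial.natDegree_X_le
    · simp
  have hωG : MvPolynomial.aeval w G = 1 + Polynomial.C lam * Polynomial.X ^ n := by
    rw [hG]
    simp only [map_add, map_mul, map_pow, MvPolynomial.aeval_X, MvPolynomial.aeval_C, hw0, hw2, hw1, one_pow,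
      zero_mul, add_zero]
    rw [← Polynomial.C_eq_algebraMap]
  -- the evaluations at `e_{i₀}` and `0`
  have ev : ∀ v : Fin d → k, MvPolynomial.eval v G = v i₀ ^ n + lam * v i₂ ^ n + v i₁ * MvPolynomial.eval v H :=
    fun v => by rw [hG]; simp only [map_add, map_mul, map_pow, MvPolynomial.eval_X, MvPolynomial.eval_C]
  have e0 : MvPolynomial.eval (Pi.single i₀ 1 : Fin d → k) G = 1 := by
    rw [ev]; simp [Pi.single_eq_of_ne' h01, Pi.single_eq_of_ne' h02, hn0]
  have ez : MvPolynomial.eval (0 : Fin d → k) G = 0 := by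
    rw [ev]; simp [hn0]
  by_contra hlt
  rw [not_le] at hlt
  have h01' : hironakaTau k ({G} : Set (MvPolynomial (Fin d) k)) = 0 ∨
      hironakaTau k ({G} : Set (MvPolynomial (Fin d) k)) = 1 := by omega
  rcases h01' with h0 | h1
  · obtain ⟨c, hc⟩ := (hironakaTau_eq_zero_iff k _).mp h0 (Set.mem_singleton _)
    have t0 := congrArg (MvPolynomial.eval (Pi.single i₀ 1 : Fin d → k)) hc
    have tz := congrArg (MvPolynomial.eval (0 : Fin d → k)) hc
    rw [MvPolynomial.eval_C] at t0 tz
    rw [e0] at t0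
    rw [ez] at tz
    exact one_ne_zero (t0.symm.trans tz)
  · obtain ⟨ℓ, -, -, hℓ⟩ := exists_forall_eq_C_mul_pow_of_hironakaTau_eq_one k h1
    obtain ⟨c, hc⟩ := hℓ G (Set.mem_singleton _) n hGh
    -- apply `ω`
    set M : Polynomial k := MvPolynomial.aeval w (linearFormPoly k ℓ) with hM
    have hMdeg : M.natDegree ≤ 1 := by
      rw [hM, linearFormPoly, map_sum]
      refine Polynomial.natDegree_sum_le_of_forall_le _ _ fun i _ => ?_
      rw [map_mul, MvPolynomial.aeval_C, MvPolynomial.aeval_X, ← Polynomial.C_eq_algebraMap]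
      exact (Polynomial.natDegree_C_mul_le _ _).trans (hwdeg i)
    have hωc : MvPolynomial.aeval w G = Polynomial.C c * M ^ n := by
      rw [hc, map_mul, map_pow, MvPolynomial.aeval_C, ← Polynomial.C_eq_algebraMap]
    obtain ⟨β, α, hβα⟩ := Polynomial.exists_eq_X_add_C_of_natDegree_le_one hMdeg
    rw [hωG, hβα, show (Polynomial.C β * Polynomial.X + Polynomial.C α : Polynomial k) =
      Polynomial.C α + Polynomial.C β * Polynomial.X from add_comm _ _] at hωc
    exact hcone (isConePower_of_one_add_eq hn hlam hωc)

variable {A : Type} [CommRing A] [IsRegularLocalRing A] {J E : Ideal A} {n a : ℕ}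

/-- **THE NON-POWER EXIT (E34), ring level** [KERNEL]: `(z, t, v)` regular parameters, `λ` a unit with `λ̄` not a cone
`n`-th power in `κ(A)`, `h = zⁿ + λ vⁿ + g ∈ J` with `g ∈ (t)`, `J ⊆ 𝔪ⁿ`, `n ≥ 2`: then `τ(J, n) ≥ 2` in a regular
system of parameters extending `(z, t, v)` — `g = t·g₁` with `g₁ ∈ 𝔪ⁿ⁻¹` (order arithmetic), so the initial form of `h`
is `Zⁿ + λ̄ Vⁿ + T·H̄`. [folklore] -/
theorem two_le_tau_nonpower {z t v lam g : A} (hztv : IsRsopPart ![z, t, v]) (hlam : IsUnit lam) (hn : 2 ≤ n)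
    (hmem : z ^ n + lam * v ^ n + g ∈ J) (hg : g ∈ Ideal.span {t}) (hJ : J ≤ maximalIdeal A ^ n)
    (hcone : ¬ IsConePower (ResidueField A) n (residue A lam)) :
    ∃ (d : ℕ) (c : Fin d → A), (maximalIdeal A).spanFinrank = d ∧ Ideal.span (Set.range c) = maximalIdeal A ∧
      2 ≤ hironakaTauAt c J n := by
  obtain ⟨e, x, hd, hx, hxi⟩ := hztv.exists_rsop
  refine ⟨3 + e, x, hd, hx, ?_⟩
  have hx0 : x (Fin.castAdd e 0) = z := hxi 0
  have hx1 : x (Fin.castAdd e 1) = t := hxi 1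
  have hx2 : x (Fin.castAdd e 2) = v := hxi 2
  have h01 : (Fin.castAdd e 0 : Fin (3 + e)) ≠ Fin.castAdd e 1 := fun h =>
    absurd (Fin.castAdd_injective 3 e h) (by decide)
  have h02 : (Fin.castAdd e 0 : Fin (3 + e)) ≠ Fin.castAdd e 2 := fun h =>
    absurd (Fin.castAdd_injective 3 e h) (by decide)
  have h12 : (Fin.castAdd e 1 : Fin (3 + e)) ≠ Fin.castAdd e 2 := fun h =>
    absurd (Fin.castAdd_injective 3 e h) (by decide)
  obtain ⟨n', rfl⟩ : ∃ n', n = n' + 2 := ⟨n - 2, by omega⟩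
  -- `g = g₁ t` with `g₁ ∈ 𝔪ⁿ⁻¹`
  obtain ⟨g₁, rfl⟩ := Ideal.mem_span_singleton'.mp hg
  have htg : g₁ * t ∈ maximalIdeal A ^ (n' + 2) := by
    have heq : g₁ * t = (z ^ (n' + 2) + lam * v ^ (n' + 2) + g₁ * t) - z ^ (n' + 2) - lam * v ^ (n' + 2) := by
      ring
    rw [heq]
    exact Ideal.sub_mem _ (Ideal.sub_mem _ (hJ hmem) (Ideal.pow_mem_pow (hztv.mem_maximalIdeal 0) _))
      (Ideal.mul_mem_left _ _ (Ideal.pow_mem_pow (hztv.mem_maximalIdeal 2) _))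
  have hg₁ : g₁ ∈ maximalIdeal A ^ (n' + 1) := by
    by_contra hc
    have ht2 : t ∉ maximalIdeal A ^ (1 + 1) := hztv.not_mem_sq 1
    exact mul_not_mem_pow_of_not_mem_pow hc ht2 htg
  -- forms
  obtain ⟨H, hHh, hHe⟩ := exists_isHomogeneous_of_mem_span_pow x (n' + 1) (by rw [hx]; exact hg₁)
  set F : MvPolynomial (Fin (3 + e)) A := X (Fin.castAdd e 0) ^ (n' + 2) +
    MvPolynomial.C lam * X (Fin.castAdd e 2) ^ (n' + 2) + X (Fin.castAdd e 1) * H with hF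
  have hFe : MvPolynomial.eval x F = z ^ (n' + 2) + lam * v ^ (n' + 2) + g₁ * t := by
    simp only [hF, map_add, map_mul, map_pow, MvPolynomial.eval_X, MvPolynomial.eval_C, hHe]
    rw [hx0, hx1, hx2]
    ring
  have hFh : F.IsHomogeneous (n' + 2) := by
    have h1 : (X (Fin.castAdd e 0) ^ (n' + 2) : MvPolynomial (Fin (3 + e)) A).IsHomogeneous (n' + 2) :=
      isHomogeneous_X_pow _ _
    have h2 : (MvPolynomial.C lam * X (Fin.castAdd e 2) ^ (n' + 2) : MvPolynomial (Fin (3 + e)) A).IsHomogeneous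
        (n' + 2) := by
      have := (isHomogeneous_C _ lam).mul (isHomogeneous_X_pow (Fin.castAdd e 2 : Fin (3 + e)) (n' + 2))
      rwa [zero_add] at this
    have h3 : (X (Fin.castAdd e 1) * H : MvPolynomial (Fin (3 + e)) A).IsHomogeneous (n' + 2) := by
      rw [show n' + 2 = 1 + (n' + 1) by omega]
      exact (isHomogeneous_X _ _).mul hHh
    exact (h1.add h2).add h3
  set G : MvPolynomial (Fin (3 + e)) (ResidueField A) := MvPolynomial.map (residue A) F with hGdef
  have hGmem : G ∈ initialForms x J (n' + 2) :=
    (mem_initialForms_iff x).mpr ⟨F, hFh, by rw [hFe]; exact hmem, rfl⟩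
  have hG : G = X (Fin.castAdd e 0) ^ (n' + 2) + MvPolynomial.C (residue A lam) * X (Fin.castAdd e 2) ^ (n' + 2) +
      X (Fin.castAdd e 1) * MvPolynomial.map (residue A) H := by
    simp only [hGdef, hF, map_add, map_mul, map_pow, MvPolynomial.map_X, MvPolynomial.map_C]
  have hGh : G.IsHomogeneous (n' + 2) := hFh.map _
  have hlam0 : residue A lam ≠ 0 := fun h =>
    (IsLocalRing.notMem_maximalIdeal.mpr hlam) ((IsLocalRing.residue_eq_zero_iff _).mp h)
  unfold hironakaTauAt
  refine (two_le_hironakaTau_pinchForm (ResidueField A) _ _ _ h01 h02 h12 (by omega) (residue A lam) hlam0 hcone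
    (MvPolynomial.map (residue A) H) G hG hGh).trans ?_
  exact Submodule.finrank_mono (directrix_mono _ (Set.singleton_subset_iff.mpr hGmem))

/-- **THE EXITS of the pinch tower, ring level** [KERNEL]: at a point of the last stage (`a < n`, `n ≥ 2`) with
`J ⊆ 𝔪ⁿ`, Hironaka's `τ(J, n) ≥ 2` in some regular system of parameters.  By the exit condition: `k + a < n` (or
`a = k = 0`) cannot occur with `J ⊆ 𝔪ⁿ` (`pinch_not_mem_pow`: `ord h = a + k < n`, resp. `h` a unit); `k + a = n`
with `a ≥ 1` is the mixed exit `pinch_two_le_tau`; `a = 0`, `k = n`, `λ̄` not a cone power is `two_le_tau_nonpower`.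
[folklore] -/
theorem PinchShape.exit (D : PinchShape J E n a) (han : a < n) (hn : 2 ≤ n) (hJ : J ≤ maximalIdeal A ^ n) :
    ∃ (d : ℕ) (c : Fin d → A), (maximalIdeal A).spanFinrank = d ∧ Ideal.span (Set.range c) = maximalIdeal A ∧
      2 ≤ hironakaTauAt c J n := by
  have hamod : a % n = a := Nat.mod_eq_of_lt han
  -- the tail splits as `g = z g₁ + u^{a+1} g₂`
  obtain ⟨g₁, hg₁, g₂, hg₂, hg⟩ := Submodule.mem_sup.mp (qWeighted_succ_le_sup' D.z D.u a n D.tail)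
  obtain ⟨b₁, hb₁⟩ := Ideal.mem_span_singleton'.mp hg₁
  obtain ⟨b₂, hb₂⟩ := Ideal.mem_span_singleton'.mp hg₂
  -- `ord h ≤ a + k`: so `a + k + 1 ≤ n` is impossible
  have hbig : n ≤ a + D.k := by
    by_contra hlt
    rw [not_le] at hlt
    obtain ⟨n₁, rfl⟩ : ∃ n₁, n = n₁ + 1 := ⟨n - 1, by omega⟩
    have heq : D.z ^ (n₁ + 1) + D.u ^ a * (D.lam * D.v ^ D.k) + D.g =
        D.u ^ a * (D.lam * D.v ^ D.k + D.u * b₂) + D.z * (D.z ^ n₁ + b₁) := by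
      rw [← hg, ← hb₁, ← hb₂]; ring
    have h := pinch_not_mem_pow (k := D.k) D.rsop D.vk D.unit a b₂ (D.z ^ n₁ + b₁)
    rw [← heq] at h
    exact h (Ideal.pow_le_pow_right (by omega) (hJ D.mem))
  rcases D.cond with ⟨hr, hkr⟩ | ⟨hr0, hk0, hkn⟩ | ⟨hr0, hk, hcone⟩
  · -- the mixed exit `k + a = n`, `a ≥ 1`, `k ≥ 1`
    rw [hamod] at hr hkr
    have hk1 : 1 ≤ D.k := by omega
    have hzuv : IsRsopPart ![D.z, D.u, D.v] := by
      rcases D.vk with h | h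
      · omega
      · exact h
    obtain ⟨e, x, hd, hx, -⟩ := D.rsop.exists_rsop
    refine ⟨2 + e, x, hd, hx, ?_⟩
    refine pinch_two_le_tau D.rsop hzuv D.unit hr hk1 (by omega) D.mem ?_ hJ x hx
    rw [← hg]
    exact Ideal.add_mem _ (Ideal.mem_sup_left hg₁) (Ideal.mem_sup_right hg₂)
  · rw [hamod] at hr0; omega
  · rw [hamod] at hr0
    subst hr0
    rcases hk with hk | hk
    · omega
    · -- the non-power exit (E34): `a = 0`, `k = n`
      have hzuv : IsRsopPart ![D.z, D.u, D.v] := by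
        rcases D.vk with h | h
        · omega
        · exact h
      have hmem : D.z ^ n + D.lam * D.v ^ n + D.g ∈ J := by
        have h := D.mem
        rwa [pow_zero, one_mul, hk] at h
      have hgu : D.g ∈ Ideal.span {D.u} := by
        refine qWeighted_two_le (fun i j hij => ?_) D.tail
        have hj : 1 ≤ j := by
          by_contra h
          have : j = 0 := by omega
          subst this
          simp at hij
        exact Ideal.mem_span_singleton.mpr (Dvd.dvd.mul_left (dvd_pow_self D.u (by omega)) _)
      exact two_le_tau_nonpower hzuv D.unit hn hmem hgu hJ hcone

end Exit

end Summit.ResolutionOfSingularities.ResolutionOfSingularities.Theorems.PinchTower
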